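import Literature.AlgebraicGeometry.AbelianSchemes.SerreTensorFrobeniusTwistPolarization
import Literature.AlgebraicGeometry.AbelianSchemes.AbelianSchemeHomDescentKernelEq
import Literature.AlgebraicGeometry.AbelianSchemes.AbelianSchemeOverQuasiInverseIsogeny
import HarnessLib

/-!
# FROB₀ in organ form: if `Ker F_{A/k,q} = Ker ι(π₀)` then `(A^{(q)}, ι^{(q)}, λ^{(q)}) ≅ (A, ι, λ)` with `F ↦ ι(π₀)`

Topic `Literature/AlgebraicGeometry/AbelianSchemes`, namespace `Literature.AlgebraicGeometry.AbelianSchemes.AbelianSchemeOver` (THEOREMS ONLY; no definition, no named fact,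
no `sorry`, no `instance`, no notation).  Cell `hodgecm-mathlib`, F0/P6 «MOD», sequel to ★ (ST-2F) `SerreTensorFrobeniusTwist`, ★ (ST-2F-λ)
`SerreTensorFrobeniusTwistPolarization` and ★ (KER-EQ) `AbelianSchemeHomDescentKernelEq`; the PRINCIPAL case of the Serre-tensor recognition of the Frobenius twist — the
shape in which HEART-FROB v4 §0∕§B∕§D uses FROB₀ («`A₀[F_q] = A₀[π₀]`, `π₀ π̄₀ = q`, `π₀` central»: the auxiliary CM factor `A₀` and the banal blocks, D11∕D12) and in which
Shimura–Taniyama enters at CM pairs (§K (I)); `--supports stmt-HodgeConjecture-24832`, count-neutral.  HC_CM is proved only modulo the 2 remaining named inputs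
(hLiu418, h413) until rung 0 closes; this file discharges none of them.

## Mathematics

`k` a field of exponential characteristic `p`, `q = pⁿ`, `A/k` an abelian variety with `𝒪`-action `ι` on `A₀ = (ofAbelianVariety A).toOver`, `F = F_{A/k,q} : A₀ → A^{(q)}`
(★ `relFrobeniusHom`), `ι^{(q)}` the base-changed action (★ `RingAction.frobeniusTwist`).
§1 For ANY `𝒪`-equivariant homomorphism `φ : A₀ → B` whose underlying map is flat, surjective and quasi-compact and whose kernel EQUALS `Ker F` on points
(`t ≫ F = 1 ↔ t ≫ φ = 1`), there is a unique `e : A^{(q)} ≅ B` with `F ≫ e = φ`, a homomorphism, `𝒪`-equivariant (★ KER-EQ: no degree count).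
§2 `φ := ι(π₀)` for `π₀ π₁ = q` in `𝒪`: `ι(π₀) ≫ ι(π₁) = ι(π₁) ≫ ι(π₀) = [q]` (★ `i_mul`, ★ `RingAction.i_natCast`), so `ι(π₀)` is finite, flat, surjective
(★ `AbelianSchemeOverQuasiInverseIsogeny`); if `Ker F = Ker ι(π₀)` then `e : A^{(q)} ≅ A₀`, `F ≫ e = ι(π₀)`, `ι^{(q)}(a) ≫ e = e ≫ ι(a)`.
§3 Polarisations: for a dual pair `D = (Â, 𝒫)` of `A₀` (unit hypothesis), `D^{(q)}` of `A^{(q)}` (★ (DF-1)), a homomorphism `λ : A₀ → Â` with the ROSATI COMPATIBILITY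
`ι(π₁) ≫ λ = λ ≫ ι(π₀)^∨` («`ι(π̄₀) = ι(π₀)†`»), the isomorphism `e` of §2 is POLARISED: `e ≫ λ ≫ e^∨_{D^{(q)},D} = λ^{(q)}` (`= λ ×_k Frobⁿ`, ★ `baseChangeHom`).
Proof: both `λ^{(q)}` and `e^*λ` pull back along `F` to `q·λ` — `F^*λ^{(q)} = qλ` is ★ (DF-2) (`relFrobeniusHom_comp_baseChangeHom_comp_dualIsogenyOver`), and
`(F ≫ e)^*λ = ι(π₀)^*λ = ι(π₀) ≫ ι(π₁) ≫ λ = [q] ≫ λ`; conclude by ★ (λ) `comp_lam_comp_dualIsogenyOver_eq_of_pullback_eq`, the quasi-inverse of `F^∨` being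
`(e ≫ ι(π₁))^∨` (`(e ≫ ι(π₁)) ≫ F = [q]_{A^{(q)}}`, ★ `dualIsogenyOver_comp_dualIsogenyOver_eq_pow_id`).

## Contents

* §1 **`exists_iso_relFrobeniusHom_comp_eq_of_comp_eq_one_iff`**.
* §2 `RingAction.i_comp_i_eq_pow_id_of_mul_eq`, `RingAction.isFinite_∕flat_∕surjective_i_left_of_mul_eq`, **`exists_iso_relFrobeniusHom_comp_eq_i`**.
* §3 `RingAction.comp_i_comp_relFrobeniusHom_eq_pow_id`, `RingAction.i_comp_lam_comp_dualIsogenyOver_i_eq`, **`comp_lam_comp_dualIsogenyOver_eq_baseChangeHom`**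
  (`e ≫ λ ≫ e^∨ = λ^{(q)}`).

## References
* [Shimura1998] G. Shimura, *Abelian Varieties with Complex Multiplication and Modular Functions* (1998), §13.1 Thm. 1 (pp. 97–99) (Shimura–Taniyama: `F = ι(π₀)` up to
  isomorphism), §18.6.
* [RapoportSmithlingZhang2020Diagonal] M. Rapoport, B. Smithling, W. Zhang (2020), §4.3 (p. 20, the auxiliary `A₀`), (4.23).
* [MumfordAV1970] D. Mumford, *Abelian Varieties* (1970), §7 Thm. 4 (p. 72), §15 Thm. 1 (p. 143), §20–§21 (Rosati), §23 (p. 231).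
* [Kottwitz1992] R. Kottwitz, JAMS 5 (1992), §5 (p. 390).
* Tree: ★ ST-2F, ★ ST-2F-λ, ★ KER-EQ, ★ `AbelianSchemeOverQuasiInverseIsogeny`, ★ `AbelianSchemeHomDescentPolarized` (λ), ★ `DualIsogenyQuasiInverse`, ★ (DF-1)∕(DF-2).
-/

noncomputable section

universe u

open CategoryTheory CategoryTheory.Limits AlgebraicGeometry MonoidalCategory CartesianMonoidalCategory
open scoped MonObj

namespace Literature.AlgebraicGeometry.AbelianSchemes

namespace AbelianSchemeOver

open Literature.AlgebraicGeometry.Motives Literature.AlgebraicGeometry.Motives.AbelianVariety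

variable {k : Type u} [Field k] (p : ℕ) [ExpChar k p] (n : ℕ) {A : AbelianVariety k} {O : Type*} [CommRing O]
  (act : (AbelianScheme.ofAbelianVariety A).toOver.RingAction O) [IsMonHom (relFrobeniusHom p n A)]

/-! ## §1 Any `𝒪`-equivariant fppf homomorphism with kernel `Ker F` is `F` up to a unique equivariant isomorphism -/

/-- **`Ker φ = Ker F_{A/k,q}` ⇒ `A^{(q)} ≅ B` under `A`, `F ↦ φ`, `𝒪`-equivariantly** (★ KER-EQ `exists_iso_comp_eq_equivariant_of_comp_eq_one_iff` with `ψ := F`, §1 of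
★ ST-2F for the fppf properties and the equivariance of `F`; no rank hypothesis). [cite: MumfordAV1970, §7 Thm. 4 (p. 72)] [cite: Shimura1998, §13.1 Thm. 1 (pp. 97–99)] -/
theorem exists_iso_relFrobeniusHom_comp_eq_of_comp_eq_one_iff {B : AbelianSchemeOver (Spec (.of k))} (actB : B.RingAction O)
    (φ : (AbelianScheme.ofAbelianVariety A).toOver.X ⟶ B.X) [IsMonHom φ] [Flat φ.left] [Surjective φ.left] [QuasiCompact φ.left]
    (hφ : ∀ a, act.i a ≫ φ = φ ≫ actB.i a)
    (hker : ∀ ⦃T : Over (Spec (.of k))⦄ (t : T ⟶ (AbelianScheme.ofAbelianVariety A).toOver.X), t ≫ relFrobeniusHom p n A = 1 ↔ t ≫ φ = 1) :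
    ∃ e : (AbelianScheme.ofAbelianVariety (A.frobeniusTwist p n)).toOver.X ≅ B.X, relFrobeniusHom p n A ≫ e.hom = φ ∧ IsMonHom e.hom ∧
      (∀ a, (act.frobeniusTwist p n).i a ≫ e.hom = e.hom ≫ actB.i a) ∧
        ∀ χ : (AbelianScheme.ofAbelianVariety (A.frobeniusTwist p n)).toOver.X ⟶ B.X, relFrobeniusHom p n A ≫ χ = φ → χ = e.hom := by
  haveI := isFinite_relFrobeniusHom_left p n A
  haveI := flat_relFrobeniusHom_left p n A
  haveI := surjective_relFrobeniusHom_left p n A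
  exact exists_iso_comp_eq_equivariant_of_comp_eq_one_iff (relFrobeniusHom p n A) φ act actB (act.frobeniusTwist p n)
    (RingAction.i_comp_relFrobeniusHom p n act) hφ hker

/-! ## §2 The endomorphism `ι(π₀)`, `π₀ π₁ = q` -/

/-- `ι(π₀) ≫ ι(π₁) = [N]` when `π₀ π₁ = N` in `𝒪` (★ `i_mul`, ★ `RingAction.i_natCast`). [cite: Kottwitz1992, §5 (p. 390)] -/
theorem RingAction.i_comp_i_eq_pow_id_of_mul_eq {π₀ π₁ : O} {N : ℕ} (h : π₀ * π₁ = (N : O)) :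
    act.i π₀ ≫ act.i π₁ = (𝟙 (AbelianScheme.ofAbelianVariety A).toOver.X) ^ N := by
  rw [← act.i_mul, mul_comm, h, RingAction.i_natCast]

/-- `ι(π₀)` is FINITE when `π₀ π₁ = N ≠ 0` (quasi-inverse `ι(π₁)`, ★ `isFinite_left_of_quasiInverse`). [cite: GortzWedhorn2023, Cor. 27.177 (1)] -/
theorem RingAction.isFinite_i_left_of_mul_eq {π₀ π₁ : O} {N : ℕ} (hN : N ≠ 0) (h : π₀ * π₁ = (N : O)) : IsFinite (act.i π₀).left := by
  haveI := act.isMonHom π₀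
  exact isFinite_left_of_quasiInverse (act.i π₀) (act.i π₁) hN (act.i_comp_i_eq_pow_id_of_mul_eq h)
    (act.i_comp_i_eq_pow_id_of_mul_eq ((mul_comm π₁ π₀).trans h))

/-- `ι(π₀)` is FLAT when `π₀ π₁ = N ≠ 0`. [cite: GortzWedhorn2023, Cor. 27.177 (1)] -/
theorem RingAction.flat_i_left_of_mul_eq {π₀ π₁ : O} {N : ℕ} (hN : N ≠ 0) (h : π₀ * π₁ = (N : O)) : Flat (act.i π₀).left := by
  haveI := act.isMonHom π₀
  exact flat_left_of_quasiInverse (act.i π₀) (act.i π₁) hN (act.i_comp_i_eq_pow_id_of_mul_eq h)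
    (act.i_comp_i_eq_pow_id_of_mul_eq ((mul_comm π₁ π₀).trans h))

/-- `ι(π₀)` is SURJECTIVE when `π₀ π₁ = N ≠ 0`. [cite: GortzWedhorn2023, Cor. 27.177 (1)] -/
theorem RingAction.surjective_i_left_of_mul_eq {π₀ π₁ : O} {N : ℕ} (hN : N ≠ 0) (h : π₀ * π₁ = (N : O)) : Surjective (act.i π₀).left := by
  haveI := act.isMonHom π₀
  exact surjective_left_of_quasiInverse (act.i π₀) (act.i π₁) hN (act.i_comp_i_eq_pow_id_of_mul_eq h)
    (act.i_comp_i_eq_pow_id_of_mul_eq ((mul_comm π₁ π₀).trans h))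

/-- **FROB₀ ⇒ `(A^{(q)}, ι^{(q)}) ≅ (A, ι)` with `F ↦ ι(π₀)`**: if `π₀ π₁ = q = pⁿ` in `𝒪` and `Ker F_{A/k,q} = Ker ι(π₀)` on points (`t ≫ F = 1 ↔ t ≫ ι(π₀) = 1`), there is a
unique isomorphism `e : A^{(q)} ≅ A₀` over `k` with `F ≫ e = ι(π₀)`; it is a homomorphism and `ι^{(q)}(a) ≫ e = e ≫ ι(a)` for all `a`.
[cite: Shimura1998, §13.1 Thm. 1 (pp. 97–99)] [cite: RapoportSmithlingZhang2020Diagonal, §4.3 (p. 20)] [cite: MumfordAV1970, §7 Thm. 4 (p. 72)] -/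
theorem exists_iso_relFrobeniusHom_comp_eq_i {π₀ π₁ : O} (hq : π₀ * π₁ = ((p ^ n : ℕ) : O))
    (hker : ∀ ⦃T : Over (Spec (.of k))⦄ (t : T ⟶ (AbelianScheme.ofAbelianVariety A).toOver.X),
      t ≫ relFrobeniusHom p n A = 1 ↔ t ≫ act.i π₀ = 1) :
    ∃ e : (AbelianScheme.ofAbelianVariety (A.frobeniusTwist p n)).toOver.X ≅ (AbelianScheme.ofAbelianVariety A).toOver.X,
      relFrobeniusHom p n A ≫ e.hom = act.i π₀ ∧ IsMonHom e.hom ∧ (∀ a, (act.frobeniusTwist p n).i a ≫ e.hom = e.hom ≫ act.i a) ∧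
        ∀ χ : (AbelianScheme.ofAbelianVariety (A.frobeniusTwist p n)).toOver.X ⟶ (AbelianScheme.ofAbelianVariety A).toOver.X,
          relFrobeniusHom p n A ≫ χ = act.i π₀ → χ = e.hom := by
  have hN : p ^ n ≠ 0 := pow_ne_zero n (expChar_pos k p).ne'
  haveI := act.isMonHom π₀
  haveI := act.isFinite_i_left_of_mul_eq hN hq
  haveI := act.flat_i_left_of_mul_eq hN hq
  haveI := act.surjective_i_left_of_mul_eq hN hq
  exact exists_iso_relFrobeniusHom_comp_eq_of_comp_eq_one_iff p n act act (act.i π₀) (fun a => act.i_comm a π₀) hker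

/-! ## §3 The isomorphism is polarised under the Rosati compatibility `ι(π₁) ≫ λ = λ ≫ ι(π₀)^∨` -/

variable (D : (AbelianScheme.ofAbelianVariety A).toOver.DualPair)
  (hD : Nonempty ((Scheme.Modules.pullback (DualPair.unitHatSlice D)).obj D.P ≅ SheafOfModules.unit _))
  (lam : (AbelianScheme.ofAbelianVariety A).toOver.X ⟶ D.hat.X) [IsMonHom lam]
  (e : (AbelianScheme.ofAbelianVariety (A.frobeniusTwist p n)).toOver.X ≅ (AbelianScheme.ofAbelianVariety A).toOver.X) [IsMonHom e.hom]

omit [IsMonHom lam] [IsMonHom (relFrobeniusHom p n A)] in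
/-- `(e ≫ ι(π₁)) ≫ F = [q]_{A^{(q)}}` when `F ≫ e = ι(π₀)` and `π₀ π₁ = q` (so `(e ≫ ι(π₁))^∨` is a quasi-inverse of `F^∨`). [cite: MumfordAV1970, §7 Thm. 4 (p. 72)] -/
theorem RingAction.comp_i_comp_relFrobeniusHom_eq_pow_id {π₀ π₁ : O} (hq : π₀ * π₁ = ((p ^ n : ℕ) : O))
    (he : relFrobeniusHom p n A ≫ e.hom = act.i π₀) :
    (e.hom ≫ act.i π₁) ≫ relFrobeniusHom p n A = (𝟙 (AbelianScheme.ofAbelianVariety (A.frobeniusTwist p n)).toOver.X) ^ (p ^ n) := by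
  have hF : relFrobeniusHom p n A = act.i π₀ ≫ e.inv := by rw [← he, Category.assoc, e.hom_inv_id, Category.comp_id]
  rw [hF, Category.assoc, ← Category.assoc (act.i π₁), act.i_comp_i_eq_pow_id_of_mul_eq ((mul_comm π₁ π₀).trans hq), ← Category.assoc,
    comp_pow_id_eq_pow_id_comp (AbelianScheme.ofAbelianVariety (A.frobeniusTwist p n)).toOver e.hom (p ^ n), Category.assoc, e.hom_inv_id,
    Category.comp_id]

omit [IsMonHom (relFrobeniusHom p n A)] [IsMonHom e.hom] in
/-- `ι(π₀) ≫ λ ≫ ι(π₀)^∨ = λ ≫ [N]_{Â}` under the Rosati compatibility `ι(π₁) ≫ λ = λ ≫ ι(π₀)^∨` and `π₀ π₁ = N`. [cite: MumfordAV1970, §20–§21 (Rosati involution)]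
[cite: Kottwitz1992, §5 (p. 390)] -/
theorem RingAction.i_comp_lam_comp_dualIsogenyOver_i_eq {π₀ π₁ : O} {N : ℕ} (hq : π₀ * π₁ = (N : O))
    (hros : act.i π₁ ≫ lam = lam ≫ @DualPair.dualIsogenyOver _ _ _ (act.i π₀) (act.isMonHom π₀) D D) :
    act.i π₀ ≫ lam ≫ @DualPair.dualIsogenyOver _ _ _ (act.i π₀) (act.isMonHom π₀) D D = lam ≫ D.hat.mulN N := by
  rw [← hros, ← Category.assoc, act.i_comp_i_eq_pow_id_of_mul_eq hq, mulN_def,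
    comp_pow_id_eq_pow_id_comp (AbelianScheme.ofAbelianVariety A).toOver lam N]

include hD in
-- `A^{(q)}.X` vs `(A₀.baseChange Frobⁿ).X` (the carrier of ★ `baseChangeHom`) agree only semireducibly (as in ★ `DualIsogenyRelFrobenius`).
set_option backward.isDefEq.respectTransparency false in
/-- **FROB₀ + ROSATI ⇒ `(A^{(q)}, ι^{(q)}, λ^{(q)}) ≅ (A, ι, λ)`**: with `e : A^{(q)} ≅ A₀`, `F ≫ e = ι(π₀)` (§2), `π₀ π₁ = q`, and a homomorphism `λ : A₀ → Â` satisfying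
`ι(π₁) ≫ λ = λ ≫ ι(π₀)^∨`, the isomorphism `e` carries `λ` to `λ^{(q)}`: **`e ≫ λ ≫ e^∨_{D^{(q)},D} = λ^{(q)}`** (both pull back along `F` to `q·λ`: ★ (DF-2) and §3;
★ (λ) polarised recognition, `F` an fppf cover, `F^∨` quasi-invertible by `(e ≫ ι(π₁))^∨`). [cite: MumfordAV1970, §23 (p. 231)] [cite: MumfordAV1970, §15 Thm. 1 (p. 143)]
[cite: Shimura1998, §13.1 Thm. 1 (pp. 97–99)] [cite: RapoportSmithlingZhang2020Diagonal, §4.3 (p. 20)] -/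
theorem comp_lam_comp_dualIsogenyOver_eq_baseChangeHom {π₀ π₁ : O} (hq : π₀ * π₁ = ((p ^ n : ℕ) : O))
    (he : relFrobeniusHom p n A ≫ e.hom = act.i π₀)
    (hros : act.i π₁ ≫ lam = lam ≫ @DualPair.dualIsogenyOver _ _ _ (act.i π₀) (act.isMonHom π₀) D D) :
    e.hom ≫ lam ≫ DualPair.dualIsogenyOver e.hom (D.frobeniusTwist p n A) D =
      baseChangeHom (A := (AbelianScheme.ofAbelianVariety A).toOver) (B := D.hat) lam (frobSpec k p n) := by
  haveI := act.isMonHom π₀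
  haveI := act.isMonHom π₁
  haveI := flat_relFrobeniusHom_left p n A
  haveI := surjective_relFrobeniusHom_left p n A
  haveI := isFinite_relFrobeniusHom_left p n A
  haveI := isMonHom_baseChangeHom (A := (AbelianScheme.ofAbelianVariety A).toOver) (B := D.hat) lam (frobSpec k p n)
  have hDq := D.nonempty_unitHatSlice_frobeniusTwist_iso p n A hD
  haveI := DualPair.isMonHom_dualIsogenyOver e.hom (D.frobeniusTwist p n A) D hD hDq
  refine comp_lam_comp_dualIsogenyOver_eq_of_pullback_eq (relFrobeniusHom p n A) D D (D.frobeniusTwist p n A) e lam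
    (baseChangeHom (A := (AbelianScheme.ofAbelianVariety A).toOver) (B := D.hat) lam (frobSpec k p n))
    (DualPair.dualIsogenyOver (e.hom ≫ act.i π₁) (D.frobeniusTwist p n A) D) (pow_ne_zero n (expChar_pos k p).ne')
    (dualIsogenyOver_comp_dualIsogenyOver_eq_pow_id (relFrobeniusHom p n A) (e.hom ≫ act.i π₁) D (D.frobeniusTwist p n A) hDq
      (act.comp_i_comp_relFrobeniusHom_eq_pow_id p n e hq he)) ?_
  -- both pull-backs along `F` are `λ ≫ [q]`
  rw [relFrobeniusHom_comp_baseChangeHom_comp_dualIsogenyOver p n A D hD lam,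
    DualPair.dualIsogenyOver_congr D D (ψ₂ := act.i π₀) (h₂ := act.isMonHom π₀) he, Category.assoc, ← Category.assoc (relFrobeniusHom p n A), he]
  exact (act.i_comp_lam_comp_dualIsogenyOver_i_eq D lam hq hros).symm

end AbelianSchemeOver

end Literature.AlgebraicGeometry.AbelianSchemes

end
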